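import Mathlib
import Summits.Ventures.PercRepro2.SwOutFrozenBaseDefs
import Summits.Ventures.PercRepro2.SwOutCubeWeak

/-!
# The frozen base: the red cluster of a root, the monotone red edge set of `h`, the antipode
containment, and the block inequality (blind cell PercRepro2, night-4 g38, 2026-08-29;
proofs/NIGHT4-G38.md §2)

At every cube point of a frozen base a red path from a root visits roots and `true` movable arms
only (`red_closed`: a root's edge to `Fz` is blue, a movable arm has no edge to `Fz`, its edges to
the outside of `H` are blue while the unit is `true`, and no edge joins two movable units), so the
red cluster of `h` is increasing in the cube point and the red edge set of `h` with it
(`redEdges_decoRealRR_mono`).  At the ANTIPODE `flipAll ω` the red cluster of `h` lies in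
`R ∪ armsFalseC ω`, every edge inside that set toggles between `ω` and its antipode (it is a
root–root edge or touches a unit), so the red edges of `h` at the antipode are blue edges of `h` at
`ω` (`redEdges_flipAll_subset_blueEdges`) — at EVERY point, not only the side points.  Together
with the injectivity of the realisation this is exactly what the weak cube principle of g36
(`card_le_of_cube_edges_weak`) needs: **`FrozenBaseE.card_decoCubeRR_le_of_lowerSet`** — the rigid
counting inequality on the block of a frozen base for every conditioning that pulls back to a
lower set of the cube.  The lower set itself (the side of the class) is the subject of
SwOutFrozenBaseHinge.
-/

namespace Summit.Ventures.PercRepro2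

namespace LocRows

open Hull

variable {V : Type*} {E : Type*}

open scoped Classical

variable {ends : E → Sym2 V}

section Mono

variable {ι : Type*} {A Z : ι → Set V} {ζ : Config E} {R H : Set V} {l : V} {RR : Finset E}
  {Fz : Set V} (hb : FrozenBaseE ends ζ R H l A Z RR Fz)
include hb

/-- **Red paths from a root visit roots and `true` movable arms only.** -/
lemma FrozenBaseE.red_closed (ω : Config (ι ⊕ ↥RR)) {x y : V}
    (hx : x ∈ R ∪ armsTrueC A (armPart ω))
    (hxy : (openGraph ends (decoRealRR ends A Z RR ζ ω)).Adj x y) :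
    y ∈ R ∪ armsTrueC A (armPart ω) := by
  obtain ⟨_, e, he, hxy⟩ := exists_edge_of_adj hxy
  rcases hx with hx | ⟨i, hi, hx⟩
  · rcases hb.root_edges e x y hx hxy with hy | ⟨j, hy⟩ | hy
    · exact Or.inl hy
    · have := (hb.decoRealRR_root_edge hx hxy hy).1 he
      exact Or.inr ⟨j, this, hy⟩
    · exfalso
      rw [hb.decoRealRR_root_fz_edge hx hxy hy] at he
      exact absurd he (by decide)
  · by_cases hyR : y ∈ R
    · exact Or.inl hyR
    by_cases hyH : y ∈ H
    · have hyF : y ∉ Fz := hb.no_arm_fz e x y hxy ⟨i, hx⟩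
      obtain ⟨j, hy⟩ := hb.arm_cover y hyH hyR hyF
      have hij : i = j := hb.unit_eq_of_edge hxy (Or.inl hx) (Or.inl hy)
      subst hij
      exact Or.inr ⟨i, hi, hy⟩
    · exfalso
      have := (hb.decoRealRR_out_edge hxy hx hyH).1 he
      simp only [armPart] at hi
      rw [hi] at this; exact absurd this (by decide)

/-- A vertex of the red cluster of a root at a cube point is a root or lies in a `true` movable
arm. -/
theorem FrozenBaseE.mem_root_or_true_of_mem_cluster (ω : Config (ι ⊕ ↥RR)) {r x : V}
    (hr : r ∈ R) (hx : x ∈ cluster ends (decoRealRR ends A Z RR ζ ω) r) :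
    x ∈ R ∨ ∃ i, armPart ω i = true ∧ x ∈ A i :=
  mem_of_conn_of_closed (S := R ∪ armsTrueC A (armPart ω))
    (fun _ hx' _ hxy => hb.red_closed ω hx' hxy) (Or.inl hr) hx

/-- The red cluster of a root at a cube point lies inside `H`. -/
theorem FrozenBaseE.cluster_subset_H (ω : Config (ι ⊕ ↥RR)) {r : V} (hr : r ∈ R) :
    cluster ends (decoRealRR ends A Z RR ζ ω) r ⊆ H := by
  intro x hx
  rcases hb.mem_root_or_true_of_mem_cluster ω hr hx with h' | ⟨i, _, hi⟩
  · exact hb.root_sub h'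
  · exact (hb.arm_sub i x hi).1

/-- The edges inside the red cluster of a root lie inside `R ∪ armsTrueC ω`. -/
lemma FrozenBaseE.within_cluster_subset {r : V} (hr : r ∈ R) (ω : Config (ι ⊕ ↥RR)) :
    within ends (cluster ends (decoRealRR ends A Z RR ζ ω) r) ⊆
      within ends (R ∪ armsTrueC A (armPart ω)) :=
  within_mono (fun x hx => by
    rcases hb.mem_root_or_true_of_mem_cluster ω hr hx with h' | ⟨i, hi, hx'⟩
    · exact Or.inl h'
    · exact Or.inr ⟨i, hi, hx'⟩)

/-- A vertex of `R ∪ armsTrueC ω` that lies in a unit has its unit `true`. -/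
lemma FrozenBaseE.unit_of_mem_true {ω : Config ι} {z : V} {i : ι}
    (hz : z ∈ R ∪ armsTrueC A ω) (hzi : z ∈ unitAZ A Z i) : ω i = true := by
  rcases hz with hz | ⟨j, hj, hz⟩
  · exact absurd hzi (hb.root_notMem_unit hz i)
  · rcases hzi with hzi | hzi
    · have hji : j = i := by
        by_contra hne
        exact hb.arm_disj j i hne z hz hzi
      rw [← hji]; exact hj
    · exact absurd hz (hb.deco_notMem_arm hzi)

/-- Two cube points agreeing on the unit of an end of an edge (and on the edge, if it joins two
roots) colour that edge alike. -/
lemma FrozenBaseE.decoRealRR_eq_of_agree {ω ω' : Config (ι ⊕ ↥RR)} {e : E}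
    (hag : ∀ i, (∃ x ∈ unitAZ A Z i, x ∈ ends e) → ω (Sum.inl i) = ω' (Sum.inl i))
    (hrr : ∀ he : e ∈ RR, ω (Sum.inr ⟨e, he⟩) = ω' (Sum.inr ⟨e, he⟩)) :
    decoRealRR ends A Z RR ζ ω e = decoRealRR ends A Z RR ζ ω' e := by
  by_cases he : e ∈ RR
  · rw [decoRealRR_apply_rr he, decoRealRR_apply_rr he, hrr he]
  by_cases ht : e ∈ touches ends (allArms (unitAZ A Z))
  · obtain ⟨i, x, y, hxy, hx⟩ := DecoBaseE.exists_unit_of_touches ht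
    rw [hb.decoRealRR_apply_of_mem hxy hx, hb.decoRealRR_apply_of_mem hxy hx,
      hag i ⟨x, hx, by rw [hxy]; exact Sym2.mem_mk_left x y⟩]
  · rw [DecoBaseE.decoRealRR_apply_of_notMem ht he, DecoBaseE.decoRealRR_apply_of_notMem ht he]

/-- A red edge inside `R ∪ armsTrueC ω` is red at every `ω' ≥ ω`. -/
lemma FrozenBaseE.decoRealRR_le_of_within_true {ω ω' : Config (ι ⊕ ↥RR)} (hω : ω ≤ ω') {e : E}
    (he : e ∈ within ends (R ∪ armsTrueC A (armPart ω)))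
    (hred : decoRealRR ends A Z RR ζ ω e = true) : decoRealRR ends A Z RR ζ ω' e = true := by
  by_cases hrr : e ∈ RR
  · rw [hb.decoRealRR_rr_edge hrr] at hred ⊢
    have := hω (Sum.inr ⟨e, hrr⟩); rw [hred] at this; exact Bool.eq_true_of_true_le this
  · rw [← hred]
    refine (hb.decoRealRR_eq_of_agree (fun i ⟨x, hx, hxe⟩ => ?_) (fun h' => absurd h' hrr)).symm
    obtain ⟨a, ha, b, hb', hab⟩ := he
    rw [hab, Sym2.mem_iff] at hxe
    have hi : armPart ω i = true := by
      rcases hxe with rfl | rfl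
      · exact hb.unit_of_mem_true ha hx
      · exact hb.unit_of_mem_true hb' hx
    have hi' : ω' (Sum.inl i) = true := by
      have := hω (Sum.inl i); simp only [armPart] at hi; rw [hi] at this
      exact Bool.eq_true_of_true_le this
    simp only [armPart] at hi
    rw [hi, hi']

/-- **The red cluster of a root is increasing in the cube point.** -/
theorem FrozenBaseE.cluster_decoRealRR_mono {r : V} (hr : r ∈ R) {ω ω' : Config (ι ⊕ ↥RR)}
    (hω : ω ≤ ω') :
    cluster ends (decoRealRR ends A Z RR ζ ω) r ⊆ cluster ends (decoRealRR ends A Z RR ζ ω') r :=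
  cluster_subset_of_le_within (S := R ∪ armsTrueC A (armPart ω))
    (fun _ hx _ hxy => hb.red_closed ω hx hxy) (Or.inl hr)
    (fun _ he hred => hb.decoRealRR_le_of_within_true hω he hred)

/-- **The red edge set of `h` is increasing in the cube point.** -/
theorem FrozenBaseE.redEdges_decoRealRR_mono {h : V} (hh : h ∈ R) {ω ω' : Config (ι ⊕ ↥RR)}
    (hω : ω ≤ ω') :
    redEdges ends (decoRealRR ends A Z RR ζ ω) h ⊆
      redEdges ends (decoRealRR ends A Z RR ζ ω') h := by
  rintro e ⟨he, hw⟩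
  exact ⟨hb.decoRealRR_le_of_within_true hω (hb.within_cluster_subset hh ω hw) he,
    within_mono (hb.cluster_decoRealRR_mono hh hω) hw⟩

/-! ### The antipode -/

/-- The flipped cube point negates every edge touching a unit or joining two roots. -/
lemma FrozenBaseE.decoRealRR_flipAll_apply {ω : Config (ι ⊕ ↥RR)} {e : E}
    (he : e ∈ touches ends (allArms (unitAZ A Z)) ∨ e ∈ RR) :
    decoRealRR ends A Z RR ζ (flipAll ω) e = !decoRealRR ends A Z RR ζ ω e := by
  by_cases hrr : e ∈ RR
  · rw [decoRealRR_apply_rr hrr, decoRealRR_apply_rr hrr]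
    by_cases hi : ω (Sum.inr ⟨e, hrr⟩) = true
    · have : flipAll ω (Sum.inr ⟨e, hrr⟩) ≠ true := by simp [flipAll, hi]
      rw [if_neg this, if_pos hi]
    · have : flipAll ω (Sum.inr ⟨e, hrr⟩) = true := by simp [flipAll]; simpa using hi
      rw [if_pos this, if_neg hi, Bool.not_not]
  · have ht : e ∈ touches ends (allArms (unitAZ A Z)) := by
      rcases he with he | he
      · exact he
      · exact absurd he hrr
    obtain ⟨i, x, y, hxy, hx⟩ := DecoBaseE.exists_unit_of_touches ht
    rw [hb.decoRealRR_apply_of_mem hxy hx, hb.decoRealRR_apply_of_mem hxy hx]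
    by_cases hi : ω (Sum.inl i) = true
    · have : flipAll ω (Sum.inl i) ≠ true := by simp [flipAll, hi]
      rw [if_neg this, if_pos hi]
    · have : flipAll ω (Sum.inl i) = true := by simp [flipAll]; simpa using hi
      rw [if_pos this, if_neg hi, Bool.not_not]

/-- An edge inside `R ∪ allArms` touches a unit or joins two roots. -/
lemma FrozenBaseE.touches_or_rr_of_within_arms {e : E}
    (he : e ∈ within ends (R ∪ allArms A)) :
    e ∈ touches ends (allArms (unitAZ A Z)) ∨ e ∈ RR := by
  obtain ⟨x, hx, y, hy, hxy⟩ := he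
  rcases hx with hxR | ⟨i, hi⟩
  · rcases hy with hyR | ⟨j, hj⟩
    · exact Or.inr (hb.mem_rr hxR hyR hxy)
    · exact Or.inl ⟨y, ⟨j, Or.inl hj⟩, x, ends_swap hxy⟩
  · exact Or.inl ⟨x, ⟨i, Or.inl hi⟩, y, hxy⟩

omit hb in
/-- The arms assigned `true` by the antipode are the arms assigned `false`. -/
lemma FrozenBaseE.armsTrueC_flipAll (ω : Config (ι ⊕ ↥RR)) :
    armsTrueC A (armPart (flipAll ω)) = armsFalseC A (armPart ω) := by
  ext x; simp [armsFalseC, armsTrueC, armPart, flipAll]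

/-- **The red cluster of a root at the antipode lies in its blue cluster at the point.** -/
theorem FrozenBaseE.cluster_flipAll_subset_cluster_blue {r : V} (hr : r ∈ R)
    (ω : Config (ι ⊕ ↥RR)) :
    cluster ends (decoRealRR ends A Z RR ζ (flipAll ω)) r ⊆
      cluster ends (blue (decoRealRR ends A Z RR ζ ω)) r := by
  refine cluster_subset_of_le_within (S := R ∪ armsTrueC A (armPart (flipAll ω)))
    (fun _ hx _ hxy => hb.red_closed (flipAll ω) hx hxy) (Or.inl hr) ?_
  intro e he hred
  have hsub : within ends (R ∪ armsTrueC A (armPart (flipAll ω))) ⊆ within ends (R ∪ allArms A) :=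
    within_mono (fun z hz => by
      rcases hz with hz | ⟨i, -, hz⟩
      · exact Or.inl hz
      · exact Or.inr ⟨i, hz⟩)
  rw [blue_apply, ← hb.decoRealRR_flipAll_apply (hb.touches_or_rr_of_within_arms (hsub he))]
  exact hred

/-- **The red edges of `h` at the antipode are blue edges of `h` at the point.** -/
theorem FrozenBaseE.redEdges_flipAll_subset_blueEdges {h : V} (hh : h ∈ R)
    (ω : Config (ι ⊕ ↥RR)) :
    redEdges ends (decoRealRR ends A Z RR ζ (flipAll ω)) h ⊆
      blueEdges ends (decoRealRR ends A Z RR ζ ω) h := by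
  rintro e ⟨he, hw⟩
  refine ⟨?_, within_mono (hb.cluster_flipAll_subset_cluster_blue hh ω) hw⟩
  have hsub : within ends (cluster ends (decoRealRR ends A Z RR ζ (flipAll ω)) h) ⊆
      within ends (R ∪ allArms A) :=
    (hb.within_cluster_subset hh (flipAll ω)).trans (within_mono (fun z hz => by
      rcases hz with hz | ⟨i, -, hz⟩
      · exact Or.inl hz
      · exact Or.inr ⟨i, hz⟩))
  rw [blue_apply, ← hb.decoRealRR_flipAll_apply (hb.touches_or_rr_of_within_arms (hsub hw))]
  exact he

/-! ### The block inequality -/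

/-- **THE BLOCK INEQUALITY OF A FROZEN BASE**: for every conditioning `Qs` that pulls back to a
lower set of the cube, the rigid counting inequality holds on the block `decoCubeRR` of a frozen
base — the weak cube principle with the monotone red edge set and the antipode containment of
this file and the injectivity of the realisation. -/
theorem FrozenBaseE.card_decoCubeRR_le_of_lowerSet [Fintype E] [DecidableEq E] [Fintype ι]
    {h : V} (hh : h ∈ R) (Qs : Set (Config E))
    (hEv : IsLowerSet {ω | decoRealRR ends A Z RR ζ ω ∈ Qs})
    {𝓔 : Set (Set E)} (h𝓔 : IsUpperSet 𝓔) :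
    ((decoCubeRR ends A Z RR ζ).filter fun ζ' => ζ' ∈ Qs ∧ redEdges ends ζ' h ∈ 𝓔).card ≤
      ((decoCubeRR ends A Z RR ζ).filter fun ζ' => ζ' ∈ Qs ∧ blueEdges ends ζ' h ∈ 𝓔).card :=
  card_le_of_cube_edges_weak (ends := ends) (decoRealRR ends A Z RR ζ) hb.decoRealRR_injective
    (decoCubeRR ends A Z RR ζ) (fun _ => mem_decoCubeRR) Qs hEv h
    (fun _ h𝓔' _ _ hω hω𝓔 => h𝓔' (hb.redEdges_decoRealRR_mono hh hω) hω𝓔)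
    (fun ω _ => hb.redEdges_flipAll_subset_blueEdges hh ω) h𝓔

end Mono

end LocRows

end Summit.Ventures.PercRepro2
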